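import Mathlib
import HarnessLib
import Summits.HubbardSuperconductivity.HubbardSuperconductivity.Theorems.KLProgrammeKLRegimeTwoVolumeTowerBaseDefs

/-!
# Route `KLProgramme` — crux K3, VL child `KLRegimeVolumeLimitV17F2` (stmt-HubbardSuperconductivity-20440), blueprint v5 M5 / W4d (data package): THE
# GRID-LEVEL DATA OF THE BASE OF THE NESTED TWO-VOLUME INDUCTION AT ONE INSTANCE (seat hubbard-kl-k3c4-p1 g13; `--supports` 20440)

`…TowerBaseGrid.tower_base_grid_keyedDefect_le` (the grid-level two-volume base defect at one instance `(L, b, M)`) takes some forty analytic inputs about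
three grid covariances — `C_L` (coarse lattice, common frame `Kc`), `C′` (fine lattice `bL`, common frame `Kc`), `C″` (fine lattice, fine frame `Kf`), all of the
form `S_Vᵀ · C^{K}_{>Λ_1}(V) · S_V` — and about the grid interaction `V_N + 𝒩_K`.  This file packages them, at one instance, as ONE structure whose parameters are
the VOLUME-FREE constants (Gram / row / column / moment numbers, field radii, majorant-series values) and the values AT THIS `L` of the rates (frame swap
`sE, cR, cC`, frame mismatch `eE`, covariance tails `T, Te`, radii `R, R′`); the kernel profiles are fields, tied to the imaginary-time weight `ε` through
`normV ≤ ε · ν̄`.  `…TowerBaseGridLimit.tower_base_grid_keyedDefect_eventually_le` turns "eventually-in-`L` `Nonempty (TowerGridData …)`" plus rates `→ 0`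
into the hypothesis `hgrid` of `…TowerBase.tower_base_keyedDefect_eventually_le`.

* **`TowerGridData`** — the structure.

Definitions only; no proof.
-/

noncomputable section

namespace Summit.HubbardSuperconductivity.HubbardSuperconductivity.Theorems.TwoVolumeSource

set_option linter.dupNamespace false -- summit = problem name (single-conjunct summit), D-0017

open Finset Literature.MathematicalPhysics.QuantumLattice GrassmannAlgebra Literature.Probability.LatticeModels
  Literature.Probability.LatticeModels.BattleFederbush
open Literature.MathematicalPhysics.QuantumLattice.FermiRG
open Summit.HubbardSuperconductivity.HubbardSuperconductivity.Theorems.KLProgrammeLegKernels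
open Summit.HubbardSuperconductivity.HubbardSuperconductivity.Theorems.KLRegimeSplit
open Summit.HubbardSuperconductivity.HubbardSuperconductivity.Theorems.TwoPointAssembly
open Summit.HubbardSuperconductivity.HubbardSuperconductivity.Theorems.EngineV8
open Summit.HubbardSuperconductivity.HubbardSuperconductivity.Theorems.TwoVolumeDefect

/-- **The grid-level base data at one instance `(L, b, M)`** (see the module docstring).  Parameters after `ε`: the volume-free constants
`κE αC κ κ' ρS ρ' ρ₂ ρf αw α α' m₁ m₁' s s' Θ νW νf ν₂ νD`, then the rate values `sE cR cC eE T Te` and radii `R R'` at this `L`.  Fields: the five kernel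
profiles and the analytic facts, in the binder order of `…TowerBaseGrid.tower_base_grid_keyedDefect_le`. [folklore: data interface; cite:
BenfattoGiulianiMastropietro2006, §2–§3] -/
structure TowerGridData (L b M : ℕ) [NeZero L] [NeZero (b * L)] (β U μ : ℝ) (Kc Kf : TrigPolyC4v) (ε : ℝ)
    (κE αC κ κ' ρS ρ' ρ₂ ρf αw α α' m₁ m₁' s s' Θ νW νf ν₂ νD : ℝ) (sE cR cC eE T Te : ℝ) (R R' : ℕ) where
  /-- even input profile of `V_N + 𝒩_{Kf}` on the fine lattice -/
  NW : ℕ → ℝ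
  /-- weighted output profile of the coarse grid action -/
  Nw : ℕ → ℝ
  /-- M4a's interaction-bracket budget profile -/
  NV : ℕ → ℝ
  /-- M4a's counterterm budget profile -/
  ND : ℕ → ℝ
  /-- M4a's frame-mismatch budget profile -/
  E : ℕ → ℝ
  hNW0 : ∀ m', 0 ≤ NW m'
  hNw0 : ∀ m', 0 ≤ Nw m'
  hNV0 : ∀ m', 0 ≤ NV m'
  hND0 : ∀ m', 0 ≤ ND m'
  hE0 : ∀ m', 0 ≤ E m'
  -- (A) the frame swap on the fine lattice: `C′` against `C″`
  hGBE : ∀ t ∈ Set.Icc (0 : ℝ) 1, IsGramBoundedR (((hubbardGridSub (b * L) M β (klGridN M)).transpose * hubbardCovAboveCT (b * L) M β μ 0 Kc (klScale klE0 1) * hubbardGridSub (b * L) M β (klGridN M)) + t • (((hubbardGridSub (b * L) M β (klGridN M)).transpose * hubbardCovAboveCT (b * L) M β μ 0 Kf (klScale klE0 1) * hubbardGridSub (b * L) M β (klGridN M)) - ((hubbardGridSub (b * L) M β (klGridN M)).transpose * hubbardCovAboveCT (b * L) M β μ 0 Kc (klScale klE0 1) * hubbardGridSub (b * L) M β (klGridN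 M)))) κE
  hrowC : ∀ x, ∑ y, ‖((hubbardGridSub (b * L) M β (klGridN M)).transpose * hubbardCovAboveCT (b * L) M β μ 0 Kc (klScale klE0 1) * hubbardGridSub (b * L) M β (klGridN M)) x y‖ ≤ αC
  hcolC : ∀ y, ∑ x, ‖((hubbardGridSub (b * L) M β (klGridN M)).transpose * hubbardCovAboveCT (b * L) M β μ 0 Kc (klScale klE0 1) * hubbardGridSub (b * L) M β (klGridN M)) x y‖ ≤ αC
  hsE : ∀ x y, ‖(((hubbardGridSub (b * L) M β (klGridN M)).transpose * hubbardCovAboveCT (b * L) M β μ 0 Kf (klScale klE0 1) * hubbardGridSub (b * L) M β (klGridN M)) - ((hubbardGridSub (b * L) M β (klGridN M)).transpose * hubbardCovAboveCT (b * L) M β μ 0 Kc (klScale klE0 1) * hubbardGridSub (b * L) M β (klGridN M))) x y‖ ≤ sE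
  hR : ∀ x, ∑ y, ‖(((hubbardGridSub (b * L) M β (klGridN M)).transpose * hubbardCovAboveCT (b * L) M β μ 0 Kf (klScale klE0 1) * hubbardGridSub (b * L) M β (klGridN M)) - ((hubbardGridSub (b * L) M β (klGridN M)).transpose * hubbardCovAboveCT (b * L) M β μ 0 Kc (klScale klE0 1) * hubbardGridSub (b * L) M β (klGridN M))) x y‖ ≤ cR
  hCc : ∀ y, ∑ x, ‖(((hubbardGridSub (b * L) M β (klGridN M)).transpose * hubbardCovAboveCT (b * L) M β μ 0 Kf (klScale klE0 1) * hubbardGridSub (b * L) M β (klGridN M)) - ((hubbardGridSub (b * L) M β (klGridN M)).transpose * hubbardCovAboveCT (b * L) M β μ 0 Kc (klScale klE0 1) * hubbardGridSub (b * L) M β (klGridN M))) x y‖ ≤ cC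
  hNW : ∀ m' (j : Fin (2 * m')) (x : GridLeg (GridPoint (b * L) (klGridN M))), ∑ Y ∈ univ.filter (fun Y : Fin (2 * m') → GridLeg (GridPoint (b * L) (klGridN M)) => Y j = x),
    ‖kernel ℂ (hubbardGridInteraction (b * L) (klGridN M) β U + hubbardGridCounterQuadratic (b * L) (klGridN M) β Kf) (2 * m') Y‖ ≤ NW m'
  hνW : normV (GridLeg (GridPoint (b * L) (klGridN M))) κE ρS NW ≤ ε * νW
  -- (B) M4a's data: radii above the frame degrees, tails, sups, rows, moments, Gram bounds, partition function, output profile, weighted rows, budgets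
  hRK : Kc.degree < R
  hRK'' : Kf.degree < R
  hT : ∀ X', ∑ Y' ∈ univ.filter (fun Y' : GridLeg (GridPoint (b * L) (klGridN M)) => R < Torus.tnorm (X'.1.1.2 - Y'.1.1.2)), ‖((hubbardGridSub (b * L) M β (klGridN M)).transpose * hubbardCovAboveCT (b * L) M β μ 0 Kc (klScale klE0 1) * hubbardGridSub (b * L) M β (klGridN M)) X' Y'‖ ≤ T
  hsec : ∀ (X' : GridLeg (GridPoint (b * L) (klGridN M))) (t : Fin (klGridN M)) (σ c : Fin 2),
    ∑ y ∈ univ.filter (fun y : TorusSite 2 (b * L) => R < Torus.tnorm (X'.1.1.2 - y)), ‖((hubbardGridSub (b * L) M β (klGridN M)).transpose * hubbardCovAboveCT (b * L) M β μ 0 Kc (klScale klE0 1) * hubbardGridSub (b * L) M β (klGridN M)) X' (((t, y), σ), c)‖ ≤ Te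
  hs : ∀ X Y, ‖((hubbardGridSub L M β (klGridN M)).transpose * hubbardCovAboveCT L M β μ 0 Kc (klScale klE0 1) * hubbardGridSub L M β (klGridN M)) X Y‖ ≤ s
  hs' : ∀ X' Y', ‖((hubbardGridSub (b * L) M β (klGridN M)).transpose * hubbardCovAboveCT (b * L) M β μ 0 Kc (klScale klE0 1) * hubbardGridSub (b * L) M β (klGridN M)) X' Y'‖ ≤ s'
  hrow : ∀ X, ∑ Y, ‖((hubbardGridSub L M β (klGridN M)).transpose * hubbardCovAboveCT L M β μ 0 Kc (klScale klE0 1) * hubbardGridSub L M β (klGridN M)) X Y‖ ≤ α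
  hrow' : ∀ X', ∑ Y', ‖((hubbardGridSub (b * L) M β (klGridN M)).transpose * hubbardCovAboveCT (b * L) M β μ 0 Kc (klScale klE0 1) * hubbardGridSub (b * L) M β (klGridN M)) X' Y'‖ ≤ α'
  hm1 : ∀ X, ∑ Y, ‖((hubbardGridSub L M β (klGridN M)).transpose * hubbardCovAboveCT L M β μ 0 Kc (klScale klE0 1) * hubbardGridSub L M β (klGridN M)) X Y‖ * (Torus.tnorm (X.1.1.2 - Y.1.1.2) : ℝ) ≤ m₁
  hm1' : ∀ X', ∑ Y', ‖((hubbardGridSub (b * L) M β (klGridN M)).transpose * hubbardCovAboveCT (b * L) M β μ 0 Kc (klScale klE0 1) * hubbardGridSub (b * L) M β (klGridN M)) X' Y'‖ * (Torus.tnorm ((fun i => (((X'.1.1.2 i).val : ℕ) : ZMod L)) - fun i => (((Y'.1.1.2 i).val : ℕ) : ZMod L)) : ℝ) ≤ m₁'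
  hGB : IsGramBoundedR ((hubbardGridSub L M β (klGridN M)).transpose * hubbardCovAboveCT L M β μ 0 Kc (klScale klE0 1) * hubbardGridSub L M β (klGridN M)) κ
  hGB' : IsGramBoundedR ((hubbardGridSub (b * L) M β (klGridN M)).transpose * hubbardCovAboveCT (b * L) M β μ 0 Kc (klScale klE0 1) * hubbardGridSub (b * L) M β (klGridN M)) κ'
  hZ : IsUnit (effPartitionFn ℂ ((hubbardGridSub L M β (klGridN M)).transpose * hubbardCovAboveCT L M β μ 0 Kc (klScale klE0 1) * hubbardGridSub L M β (klGridN M)) (hubbardGridInteraction L (klGridN M) β U + hubbardGridCounterQuadratic L (klGridN M) β Kc))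
  hNw : ∀ (m' : ℕ) (j : Fin (2 * m')) (x : GridLeg (GridPoint L (klGridN M))), ∑ Y ∈ univ.filter (fun Y : Fin (2 * m') → GridLeg (GridPoint L (klGridN M)) => Y j = x),
    ‖kernel ℂ (effAction ℂ ((hubbardGridSub L M β (klGridN M)).transpose * hubbardCovAboveCT L M β μ 0 Kc (klScale klE0 1) * hubbardGridSub L M β (klGridN M)) (hubbardGridInteraction L (klGridN M) β U + hubbardGridCounterQuadratic L (klGridN M) β Kc)) (2 * m') Y‖ * (1 + labelDiam (fun Y₁ Y₂ : GridLeg (GridPoint L (klGridN M)) => (Torus.tnorm (Y₁.1.1.2 - Y₂.1.1.2) : ℝ)) (univ.image Y)) ≤ Nw m'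
  hνf : normV (GridLeg (GridPoint (b * L) (klGridN M))) (κ' + κ) ρf Nw ≤ ε * νf
  hν₂ : normV (GridLeg (GridPoint (b * L) (klGridN M))) (κ' + κ + (κ' + κ + (κ' + κ))) ρ₂ Nw ≤ ε * ν₂
  hroww : ∀ X', ∑ Y', ‖((hubbardGridSub (b * L) M β (klGridN M)).transpose * hubbardCovAboveCT (b * L) M β μ 0 Kc (klScale klE0 1) * hubbardGridSub (b * L) M β (klGridN M)) X' Y'‖ * (1 + (Torus.tnorm ((fun i => (((X'.1.1.2 i).val : ℕ) : ZMod L)) - fun i => (((Y'.1.1.2 i).val : ℕ) : ZMod L)) : ℝ)) ≤ αw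
  hcolw : ∀ Y', ∑ X', ‖((hubbardGridSub (b * L) M β (klGridN M)).transpose * hubbardCovAboveCT (b * L) M β μ 0 Kc (klScale klE0 1) * hubbardGridSub (b * L) M β (klGridN M)) X' Y'‖ * (1 + (Torus.tnorm ((fun i => (((X'.1.1.2 i).val : ℕ) : ZMod L)) - fun i => (((Y'.1.1.2 i).val : ℕ) : ZMod L)) : ℝ)) ≤ αw
  hNV : ∀ m', (if m' = 1 then |β| / (klGridN M : ℕ) * ∑ z : TorusSite 2 L, ‖framePosKernel L Kc z‖ * (1 + torusSiteDist z 0)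
    else if m' = 2 then |U| * |β| / (klGridN M : ℕ) else 0 : ℝ) ≤ NV m'
  hND : (1 + (R : ℝ)) * (|β| / (klGridN M : ℕ) * (Kf.coeffNorm 0 + Kc.coeffNorm 0)) ≤ ND 1
  hE : |β| / (klGridN M : ℕ) * (fsub Kf Kc).coeffNorm 0 ≤ E 1
  heE : normV (GridLeg (GridPoint (b * L) (klGridN M))) κ' ρ' E ≤ ε * eE
  hνD : normV (GridLeg (GridPoint (b * L) (klGridN M))) κ' ρ' ND ≤ ε * ((1 + (R : ℝ)) * νD)
  hΘ1 : normV (GridLeg (GridPoint (b * L) (klGridN M))) κ' ρ' (fun m' => NV m' + ND m') + normV (GridLeg (GridPoint (b * L) (klGridN M))) κ' ρ' E ≤ Θ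
  hΘ2 : normV (GridLeg (GridPoint (b * L) (klGridN M))) κ' ρ' NV + normV (GridLeg (GridPoint (b * L) (klGridN M))) κ' ρ' ND ≤ Θ

end Summit.HubbardSuperconductivity.HubbardSuperconductivity.Theorems.TwoVolumeSource

end
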